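import Summits.AtomisticToContinuum.Crystallization.Theorems.ChargedEnergyGapOctahedralLedgerC
import HarnessLib

/-!
# ChargedEnergyGap · NODE 73 «OctahedralLedger», part D (lens-3 g73 addendum): piece (C) `OctCollarQ` PROVED

The collar piece of the octahedral ledger (part A §L3), (C) `OctCollarQ … κ₂ := ∃ c_H ≥ 0, (thirteen-binder quantised block) →
−c_H·pricedNearCountL ≤ octCollarL`, is proved OUTRIGHT at the designate dials `s = 3/5, τ = 3/100, ϱ = 160, r₁ = 6/5, r₂ = 3/2, κ₂ = 1/2`
for EVERY class `cls` and all other dials (`octCollarQ_designate`).  The constant `c_H` is EXISTENTIAL in (C) — as in [MID-q] and (H-q): the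
reduction leaf (N-q) quantifies over it, priced sites being excised for free — so a CRUDE VOLUME-PACKING constant suffices and no lattice
geometry (framing) is needed:
* §D1 every ordered pair term is `≥ −(1/2)·(3τ)² = −81/20000`: weight in `[0, 1]`, zero on `X` (`siteW_nonneg/le_one/of_mem`); ledger coefficient
  `≥ −1/2` (`¼` on edges, `¼(14d⁻¹⁴ − 8d⁻⁸) ≥ −2(5/6)⁸ > −1/2` for `d > 6/5`, `ljBar_coef_lb`); squared elongation `≤ ‖β p q‖² ≤ (τ·dist)² ≤ (9/100)²`
  (`SmallStrain`; all sites of the octahedron of a mid pair `(y, z)` lie within `r₂ = 3/2` of `y`);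
* §D2 hence `octForm ≥ −(81/20000)·216²` (at most `((2·3/2 + 3/5)/(3/5))³ = 216` reference sites within `3/2` of `y`, `IsSeparatedRef.card_le`)
  and `octSiteWith π ≥ −(81/20000)·216³/6` for ANY selector `π`;
* §D3 a motif site `y` with a non-zero collar summand has an EXCISED octahedron site `x = x₀ + g` (`x₀ ∈ motif`, `g ∈ lattice`) and a POSITIVELY
  WEIGHTED non-excised one `p`, both within `3/2` of `y`; translating `p` by `−g` (invariance of `X`, `C`, `Dᵢ`: `profileWeight_add_of_isInvariantSet`,
  `localFactor_add_of_isInvariantSet`) shows `x₀` is PRICED (`dist < 3 < 3ϱ/8 = 60`) with `dist (y − g) x₀ ≤ 3/2` (`collar_witness`);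
* §D4 at most `216` motif sites are so attached to one `x₀` (`y ↦ y − g(y)` is injective by motif inequivalence `eq_of_sub_mem`), so the non-zero
  collar summands number `≤ 216·pricedNearCountL` (`Finset.card_biUnion_le`) and `c_H = (81/20000)·216⁴/6 ≈ 1.47e6` works.
CONE UPGRADE (§D5): `chargedEnergyGap_of_octahedralLedger_numerics'` — part C's numerics cone with (C) discharged: twenty leaves + the floor
`1/8 ≤ b₁` + the census form `Fcc.FccScaleNumerics`; of NODE 73's five pieces only (L) `OctLedgerQ` (bookkeeping) and (K₁) `OctShellQ` (THE CRUX)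
remain open.  No `sorry`, no new axioms, no instances, `def`-free.
-/

noncomputable section

open scoped Classical
open Literature.MathematicalPhysics.StatisticalMechanics Literature.Geometry.DiscreteGeometry
open Summit.AtomisticToContinuum.Crystallization.Theses.PricedLinkCensus
open Summit.AtomisticToContinuum.Crystallization.Theorems.ChargedEnergyGapNegative

namespace Summit.AtomisticToContinuum.Crystallization.Theorems.ChargedEnergyGapChartDial

/-! ## §D1 The ordered pair term is bounded below -/

section PairTerm

variable {P : PeriodicConfiguration 3}

/-- `V″(d) − V′(d)/d = 14d⁻¹⁴ − 8d⁻⁸ ≥ −2` for `d > 6/5`. -/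
theorem ljBar_coef_lb {d : ℝ} (hd : 6 / 5 < d) : -2 ≤ ljD2 d - ljD1 d / d := by
  have hd0 : 0 < d := by linarith
  have ht0 : 0 < d⁻¹ := inv_pos.2 hd0
  have ht1 : d⁻¹ ≤ 5 / 6 := by rw [inv_le_comm₀ hd0 (by norm_num)]; norm_num; exact hd.le
  have h8 : (d⁻¹) ^ 8 ≤ 1 / 4 := (pow_le_pow_left₀ ht0.le ht1 8).trans (by norm_num)
  have h14 : 0 ≤ (d⁻¹) ^ 14 := pow_nonneg ht0.le 14
  have hrw : ljD2 d - ljD1 d / d = 14 * (d⁻¹) ^ 14 - 8 * (d⁻¹) ^ 8 := by unfold ljD1 ljD2; rw [div_eq_mul_inv]; ring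
  rw [hrw]; linarith

/-- The ledger coefficient at `κ₂ = 1/2`, `r₁ = 6/5` is `≥ −1/2`. -/
theorem octCoef_lb (p q : E3) : -(1 / 2) ≤ octCoef (1 / 2) (6 / 5) p q := by
  unfold octCoef
  split_ifs with h
  · norm_num
  · have := ljBar_coef_lb (lt_of_not_ge h); linarith

/-- The squared longitudinal component is at most the squared norm of the pair field. -/
theorem pairElong_sq_le (β : E3 → E3 → E3) (p q : E3) : pairElong β p q ^ 2 ≤ ‖β p q‖ ^ 2 := by
  unfold pairElong
  have hu : ‖(dist p q)⁻¹ • (q - p)‖ ≤ 1 := by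
    rw [norm_smul, norm_inv, Real.norm_eq_abs, abs_of_nonneg dist_nonneg, ← dist_eq_norm, dist_comm q p]
    rcases eq_or_ne (dist p q) 0 with h | h
    · rw [h]; simp
    · rw [inv_mul_cancel₀ h]
  have h2 : |inner ℝ ((dist p q)⁻¹ • (q - p)) (β p q)| ≤ ‖β p q‖ :=
    (abs_real_inner_le_norm _ _).trans (mul_le_of_le_one_left (norm_nonneg _) hu)
  exact sq_le_sq' (abs_le.1 h2).1 (abs_le.1 h2).2

/-- ★ Every ordered pair term with weight in `[0, 1]` vanishing on `X`, under `SmallStrain 3/100`, between reference sites at distance `≤ 3`, is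
`≥ −(1/2)·(9/100)² = −81/20000`. -/
theorem octPairTerm_lb {X : Set E3} {β : E3 → E3 → E3} {W : E3 → ℝ} (hW0 : ∀ x, 0 ≤ W x) (hW1 : ∀ x, W x ≤ 1)
    (hWX : ∀ x ∈ X, W x = 0) (hS : SmallStrain (3 / 100) P X β) {p q : E3} (hp : p ∈ P.points) (hq : q ∈ P.points)
    (hd : dist p q ≤ 3) : -(81 / 20000) ≤ octPairTerm (1 / 2) (6 / 5) W X β p q := by
  unfold octPairTerm
  split_ifs with h
  · obtain ⟨_, hqX⟩ := h
    by_cases hpX : p ∈ X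
    · rw [hWX p hpX, zero_mul]; norm_num
    · have hβ3 : ‖β p q‖ ≤ 9 / 100 := by linarith [hS p hp q hq hpX hqX]
      have hpe : pairElong β p q ^ 2 ≤ 81 / 10000 := (pairElong_sq_le β p q).trans (by nlinarith [norm_nonneg (β p q)])
      have hc : -(1 / 2) ≤ octCoef (1 / 2) (6 / 5) p q := octCoef_lb p q
      have hpe0 : 0 ≤ pairElong β p q ^ 2 := sq_nonneg _
      have h1 : -(81 / 20000) ≤ octCoef (1 / 2) (6 / 5) p q * pairElong β p q ^ 2 := by nlinarith
      have h2 : 0 ≤ W p * (octCoef (1 / 2) (6 / 5) p q * pairElong β p q ^ 2 + 81 / 20000) := mul_nonneg (hW0 p) (by linarith)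
      nlinarith [hW1 p, hW0 p]
  · norm_num

/-- The site weight is at most `1`. -/
theorem siteW_le_one (ϱχ : ℝ) {m : ℕ} (D : Fin m → Set E3) (σ : Fin m → Bool) (X : Set E3) (ϱ : ℝ) (C : Set E3) (y : E3) :
    siteW ϱχ D σ X ϱ C y ≤ 1 := by
  unfold siteW
  split_ifs
  · norm_num
  · nlinarith [localFactor_nonneg (ϱχ := ϱχ) (D := D) (σ := σ) y, localFactor_le_one (ϱχ := ϱχ) (D := D) (σ := σ) y,
      profileWeight_nonneg ϱ C y, profileWeight_le_one ϱ C y]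

end PairTerm

/-! ## §D2 The octahedron form and the octahedral site functional are bounded below -/

section FormBound

variable {P : PeriodicConfiguration 3}

/-- The sites of the octahedron of a mid pair `(y, z)` (`dist y z ≤ 3/2`) lie within `3/2` of `y`. -/
theorem InOct.dist_le {y z x : E3} (hx : InOct P (6 / 5) y z x) (hyz : dist y z ≤ 3 / 2) : x ∈ P.points ∧ dist x y ≤ 3 / 2 := by
  refine ⟨hx.1, ?_⟩
  rcases hx.2 with rfl | rfl | ⟨h, _⟩
  · rw [dist_self]; norm_num
  · rwa [dist_comm]
  · rw [dist_comm]; linarith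

/-- At most `216` reference sites lie within `3/2` of any point of a `3/5`-separated reference. -/
theorem card_near_le (h1 : IsSeparatedRef (3 / 5) P) (y : E3) (T : Finset E3) (hT : ∀ p ∈ T, p ∈ P.points ∧ dist p y ≤ 3 / 2) :
    (T.card : ℝ) ≤ 216 := by
  have := h1.card_le (by norm_num) (by norm_num : (0 : ℝ) ≤ 3 / 2) y T hT
  norm_num at this
  exact_mod_cast this

/-- ★ `octForm ≥ −(81/20000)·216²` for a mid pair of a separated reference under the block's strain bound. -/
theorem octForm_lb (h1 : IsSeparatedRef (3 / 5) P) {X : Set E3} {β : E3 → E3 → E3} {W : E3 → ℝ} (hW0 : ∀ x, 0 ≤ W x)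
    (hW1 : ∀ x, W x ≤ 1) (hWX : ∀ x ∈ X, W x = 0) (hS : SmallStrain (3 / 100) P X β) {y z : E3} (hyz : dist y z ≤ 3 / 2) :
    -(81 / 20000 * 216 ^ 2) ≤ octForm (1 / 2) (6 / 5) W X β P y z := by
  classical
  have hF := h1.finite_inter_closedBall (by norm_num) y (3 / 2)
  set T : Finset E3 := hF.toFinset with hT
  have hmemT : ∀ x, InOct P (6 / 5) y z x → x ∈ T := fun x hx => by
    rw [hT, Set.Finite.mem_toFinset]
    exact ⟨(hx.dist_le hyz).1, Metric.mem_closedBall.2 (hx.dist_le hyz).2⟩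
  have hTmem : ∀ p ∈ T, p ∈ P.points ∧ dist p y ≤ 3 / 2 := fun p hp => by
    rw [hT, Set.Finite.mem_toFinset] at hp; exact ⟨hp.1, Metric.mem_closedBall.1 hp.2⟩
  have hcard : (T.card : ℝ) ≤ 216 := card_near_le h1 y T hTmem
  unfold octForm
  have inner_eq : ∀ p : E3, (∑ᶠ q : E3, if InOct P (6 / 5) y z p ∧ InOct P (6 / 5) y z q then octPairTerm (1 / 2) (6 / 5) W X β p q else 0) =
      ∑ q ∈ T, if InOct P (6 / 5) y z p ∧ InOct P (6 / 5) y z q then octPairTerm (1 / 2) (6 / 5) W X β p q else 0 := by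
    intro p
    apply finsum_eq_sum_of_support_subset
    intro q hq
    by_contra hqV
    exact (Function.mem_support.1 hq) (if_neg fun h' => hqV (hmemT q h'.2))
  simp_rw [inner_eq]
  rw [finsum_eq_sum_of_support_subset (s := T)]
  · have hterm : ∀ p ∈ T, ∀ q ∈ T,
        -(81 / 20000 : ℝ) ≤ (if InOct P (6 / 5) y z p ∧ InOct P (6 / 5) y z q then octPairTerm (1 / 2) (6 / 5) W X β p q else 0) := by
      intro p hp q hq
      split_ifs with h
      · refine octPairTerm_lb hW0 hW1 hWX hS h.1.1 h.2.1 ?_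
        have h3 := dist_triangle p y q
        rw [dist_comm y q] at h3
        linarith [(hTmem p hp).2, (hTmem q hq).2]
      · norm_num
    have hc0 : (0 : ℝ) ≤ T.card := Nat.cast_nonneg _
    calc -(81 / 20000 * 216 ^ 2 : ℝ) ≤ ∑ p ∈ T, ∑ q ∈ T, (-(81 / 20000) : ℝ) := by
          simp only [Finset.sum_const, nsmul_eq_mul]; nlinarith
      _ ≤ _ := Finset.sum_le_sum fun p hp => Finset.sum_le_sum fun q hq => hterm p hp q hq
  · intro p hp
    by_contra hpV
    exact (Function.mem_support.1 hp) (Finset.sum_eq_zero fun q _ => if_neg fun h' => hpV (hmemT p h'.1))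

/-- ★ `octSiteWith π ≥ −(81/20000)·216³/6` for ANY selector `π`. -/
theorem octSiteWith_lb (h1 : IsSeparatedRef (3 / 5) P) {X : Set E3} {β : E3 → E3 → E3} {W : E3 → ℝ} (hW0 : ∀ x, 0 ≤ W x)
    (hW1 : ∀ x, W x ≤ 1) (hWX : ∀ x ∈ X, W x = 0) (hS : SmallStrain (3 / 100) P X β) (π : E3 → E3 → Prop) (y : E3) :
    -(81 / 20000 * 216 ^ 2 / 6 * 216) ≤ octSiteWith π (1 / 2) (6 / 5) (3 / 2) W X β P y := by
  classical
  have hF := h1.finite_inter_closedBall (by norm_num) y (3 / 2)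
  set T : Finset E3 := hF.toFinset with hT
  have hTmem : ∀ p ∈ T, p ∈ P.points ∧ dist p y ≤ 3 / 2 := fun p hp => by
    rw [hT, Set.Finite.mem_toFinset] at hp; exact ⟨hp.1, Metric.mem_closedBall.1 hp.2⟩
  have hcard : (T.card : ℝ) ≤ 216 := card_near_le h1 y T hTmem
  have hmemT : ∀ z, z ∈ P.points → dist y z ≤ 3 / 2 → z ∈ T := fun z hz hd => by
    rw [hT, Set.Finite.mem_toFinset]
    exact ⟨hz, Metric.mem_closedBall.2 (by rw [dist_comm]; exact hd)⟩
  unfold octSiteWith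
  rw [finsum_eq_sum_of_support_subset (s := T)]
  · have hterm : ∀ z ∈ T, -(81 / 20000 * 216 ^ 2 / 6 : ℝ) ≤
        (if (z ∈ P.points ∧ 6 / 5 < dist y z ∧ dist y z ≤ 3 / 2) ∧ π y z then (1 / 6) * octForm (1 / 2) (6 / 5) W X β P y z else 0) := by
      intro z _
      split_ifs with h
      · have := octForm_lb h1 hW0 hW1 hWX hS h.1.2.2; linarith
      · norm_num
    have hc0 : (0 : ℝ) ≤ T.card := Nat.cast_nonneg _
    calc -(81 / 20000 * 216 ^ 2 / 6 * 216 : ℝ) ≤ ∑ z ∈ T, (-(81 / 20000 * 216 ^ 2 / 6) : ℝ) := by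
          simp only [Finset.sum_const, nsmul_eq_mul]; nlinarith
      _ ≤ _ := Finset.sum_le_sum hterm
  · intro z hz
    by_contra hzT
    exact (Function.mem_support.1 hz) (if_neg fun h' => hzT (hmemT z h'.1.1 h'.1.2.2))

end FormBound

/-! ## §D3 A non-zero collar summand prices an excised motif site nearby -/

section Witness

variable {P : PeriodicConfiguration 3}

/-- `exists_of_finsum_ne_zero` (docstring added by the landing lane; see the module docstring). [formal bookkeeping] -/
theorem exists_of_finsum_ne_zero {α : Type*} {f : α → ℝ} (h : ∑ᶠ a, f a ≠ 0) : ∃ a, f a ≠ 0 := by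
  by_contra hall
  simp only [not_exists, not_not] at hall
  exact h (by rw [show f = fun _ => (0 : ℝ) from funext hall]; exact finsum_zero)

/-- A non-zero octahedron form has an ordered pair term that is present with a non-zero first weight. -/
theorem octForm_ne_zero_witness {κ₂ r₁ : ℝ} {W : E3 → ℝ} {X : Set E3} {β : E3 → E3 → E3} {y z : E3}
    (h : octForm κ₂ r₁ W X β P y z ≠ 0) : ∃ p q : E3, InOct P r₁ y z p ∧ InOct P r₁ y z q ∧ q ∉ X ∧ W p ≠ 0 := by
  obtain ⟨p, hp⟩ := exists_of_finsum_ne_zero h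
  obtain ⟨q, hq⟩ := exists_of_finsum_ne_zero hp
  by_cases hpq : InOct P r₁ y z p ∧ InOct P r₁ y z q
  · rw [if_pos hpq] at hq
    unfold octPairTerm at hq
    by_cases hc : p ≠ q ∧ q ∉ X
    · rw [if_pos hc] at hq
      exact ⟨p, q, hpq.1, hpq.2, hc.2, fun hW => hq (by rw [hW, zero_mul])⟩
    · exact absurd (if_neg hc) hq
  · exact absurd (if_neg hpq) hq

/-- ★ A motif site `y` with a non-zero collar summand is attached — by a lattice vector `g` with `dist (y + g) x₀ ≤ 3/2` — to a PRICED excised motif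
site `x₀`. -/
theorem collar_witness (ϱχ : ℝ) {m : ℕ} {D : Fin m → Set E3} (σ : Fin m → Bool) {X C : Set E3} {β : E3 → E3 → E3}
    (h6 : IsInvariantSet P C) (h7 : IsInvariantSet P X) (h11 : ∀ i, IsInvariantSet P (D i)) {y : E3} (hyP : y ∈ P.points)
    (hy : octSiteWith (fun y z => ¬OctClean P (6 / 5) X y z) (1 / 2) (6 / 5) (3 / 2) (siteW ϱχ D σ X 160 C) X β P y ≠ 0) :
    ∃ x₀ ∈ P.motif.filter (fun y => y ∈ X ∧ ∃ z ∈ P.points, z ∉ X ∧ 0 < localFactor ϱχ D σ z * profileWeight 160 C z ∧ dist y z < 3 * 160 / 8),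
      ∃ g ∈ P.lattice, y + g ∈ P.points ∧ dist (y + g) x₀ ≤ 3 / 2 := by
  obtain ⟨z, hz⟩ := exists_of_finsum_ne_zero hy
  by_cases hc : (z ∈ P.points ∧ 6 / 5 < dist y z ∧ dist y z ≤ 3 / 2) ∧ ¬OctClean P (6 / 5) X y z
  · rw [if_pos hc] at hz
    obtain ⟨⟨hzP, _, hyz⟩, hcl⟩ := hc
    have hF : octForm (1 / 2) (6 / 5) (siteW ϱχ D σ X 160 C) X β P y z ≠ 0 := fun h0 => hz (by rw [h0, mul_zero])
    obtain ⟨p, q, hp, _, _, hWp⟩ := octForm_ne_zero_witness hF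
    -- an excised site of the octahedron
    simp only [OctClean, not_forall, not_not, exists_prop] at hcl
    obtain ⟨x, hx, hxX⟩ := hcl
    -- the positively weighted site `p`
    have hpX : p ∉ X := fun hpX => hWp (siteW_of_mem 160 C hpX)
    have hWp' : 0 < localFactor ϱχ D σ p * profileWeight 160 C p := by
      have hne : localFactor ϱχ D σ p * profileWeight 160 C p ≠ 0 := by
        intro h0; apply hWp; unfold siteW; rw [if_neg hpX, h0]
      exact lt_of_le_of_ne (mul_nonneg (localFactor_nonneg (ϱχ := ϱχ) (D := D) (σ := σ) p) (profileWeight_nonneg 160 C p)) hne.symm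
    obtain ⟨hpP, hpy⟩ := hp.dist_le hyz
    obtain ⟨hxP, hxy⟩ := hx.dist_le hyz
    -- decompose `x = x₀ + g`
    obtain ⟨x₀, hx₀, g, hg, hxe⟩ := hxP
    have hng : -g ∈ P.lattice := P.lattice.neg_mem hg
    refine ⟨x₀, Finset.mem_filter.2 ⟨hx₀, ?_, p + -g, P.add_mem_points hpP hng, ?_, ?_, ?_⟩, -g, hng, P.add_mem_points hyP hng, ?_⟩
    · have := (h7 g hg x₀).1 (by rw [← hxe]; exact hxX); exact this
    · exact fun h => hpX ((h7 (-g) hng p).1 h)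
    · rw [localFactor_add_of_isInvariantSet ϱχ h11 σ hng, profileWeight_add_of_isInvariantSet 160 h6 hng]; exact hWp'
    · have hd : dist x₀ (p + -g) = dist x p := by
        rw [dist_eq_norm, dist_eq_norm, hxe]; congr 1; abel
      rw [hd]
      have := dist_triangle x y p
      rw [dist_comm y p] at this
      linarith
    · have hd : dist (y + -g) x₀ = dist y x := by
        rw [dist_eq_norm, dist_eq_norm, hxe]; congr 1; abel
      rw [hd, dist_comm]; exact hxy
  · exact absurd (if_neg hc) hz

end Witness

/-! ## §D4 Counting: non-zero collar summands against priced motif sites -/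

section Counting

variable {P : PeriodicConfiguration 3}

/-- At most `216` motif sites are attached (by a lattice vector, within `3/2`) to a given point: `y ↦ y + g(y)` is injective on the motif. -/
theorem card_attached_le (h1 : IsSeparatedRef (3 / 5) P) (x₀ : E3) :
    ((P.motif.filter fun y => ∃ g ∈ P.lattice, y + g ∈ P.points ∧ dist (y + g) x₀ ≤ 3 / 2).card : ℝ) ≤ 216 := by
  classical
  have hF := h1.finite_inter_closedBall (by norm_num) x₀ (3 / 2)
  set T : Finset E3 := hF.toFinset with hT
  have hTmem : ∀ p ∈ T, p ∈ P.points ∧ dist p x₀ ≤ 3 / 2 := fun p hp => by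
    rw [hT, Set.Finite.mem_toFinset] at hp; exact ⟨hp.1, Metric.mem_closedBall.1 hp.2⟩
  have hcard : (T.card : ℝ) ≤ 216 := card_near_le h1 x₀ T hTmem
  set A : Finset E3 := P.motif.filter fun y => ∃ g ∈ P.lattice, y + g ∈ P.points ∧ dist (y + g) x₀ ≤ 3 / 2 with hA
  have hgsel : ∀ y ∈ A, Classical.epsilon (fun g => g ∈ P.lattice ∧ y + g ∈ P.points ∧ dist (y + g) x₀ ≤ 3 / 2) ∈ P.lattice ∧
      y + Classical.epsilon (fun g => g ∈ P.lattice ∧ y + g ∈ P.points ∧ dist (y + g) x₀ ≤ 3 / 2) ∈ P.points ∧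
      dist (y + Classical.epsilon (fun g => g ∈ P.lattice ∧ y + g ∈ P.points ∧ dist (y + g) x₀ ≤ 3 / 2)) x₀ ≤ 3 / 2 := by
    intro y hy
    obtain ⟨_, g, hg, hgP, hgd⟩ := Finset.mem_filter.1 hy
    exact Classical.epsilon_spec (p := fun g => g ∈ P.lattice ∧ y + g ∈ P.points ∧ dist (y + g) x₀ ≤ 3 / 2) ⟨g, hg, hgP, hgd⟩
  have hle : A.card ≤ T.card := by
    refine Finset.card_le_card_of_injOn
      (fun y => y + Classical.epsilon (fun g => g ∈ P.lattice ∧ y + g ∈ P.points ∧ dist (y + g) x₀ ≤ 3 / 2))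
      (fun y hy => ?_) (fun y hy y' hy' hyy' => ?_)
    · have h := hgsel y (Finset.mem_coe.1 hy)
      rw [Finset.mem_coe, hT, Set.Finite.mem_toFinset]
      exact ⟨h.2.1, Metric.mem_closedBall.2 h.2.2⟩
    · have hyM := (Finset.mem_filter.1 (Finset.mem_coe.1 hy)).1
      have hyM' := (Finset.mem_filter.1 (Finset.mem_coe.1 hy')).1
      have hg := (hgsel y (Finset.mem_coe.1 hy)).1
      have hg' := (hgsel y' (Finset.mem_coe.1 hy')).1
      refine P.eq_of_sub_mem y hyM y' hyM' ?_
      have hyy : y + Classical.epsilon (fun g => g ∈ P.lattice ∧ y + g ∈ P.points ∧ dist (y + g) x₀ ≤ 3 / 2) =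
          y' + Classical.epsilon (fun g => g ∈ P.lattice ∧ y' + g ∈ P.points ∧ dist (y' + g) x₀ ≤ 3 / 2) := hyy'
      have hsub : y - y' = Classical.epsilon (fun g => g ∈ P.lattice ∧ y' + g ∈ P.points ∧ dist (y' + g) x₀ ≤ 3 / 2) -
          Classical.epsilon (fun g => g ∈ P.lattice ∧ y + g ∈ P.points ∧ dist (y + g) x₀ ≤ 3 / 2) := by
        rw [sub_eq_sub_iff_add_eq_add, hyy, add_comm]
      rw [hsub]
      exact P.lattice.sub_mem hg' hg
  have : (A.card : ℝ) ≤ T.card := by exact_mod_cast hle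
  exact this.trans hcard

/-- ★ The number of motif sites with a non-zero collar summand is at most `216·pricedNearCountL`. -/
theorem card_collar_ne_zero_le (h1 : IsSeparatedRef (3 / 5) P) (ϱχ : ℝ) {m : ℕ} {D : Fin m → Set E3} (σ : Fin m → Bool)
    {X C : Set E3} {β : E3 → E3 → E3} (h6 : IsInvariantSet P C) (h7 : IsInvariantSet P X) (h11 : ∀ i, IsInvariantSet P (D i)) :
    ((P.motif.filter fun y =>
        octSiteWith (fun y z => ¬OctClean P (6 / 5) X y z) (1 / 2) (6 / 5) (3 / 2) (siteW ϱχ D σ X 160 C) X β P y ≠ 0).card : ℝ) ≤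
      216 * (pricedNearCountL ϱχ D σ P X 160 C : ℝ) := by
  classical
  set F : Finset E3 := P.motif.filter fun y =>
    y ∈ X ∧ ∃ z ∈ P.points, z ∉ X ∧ 0 < localFactor ϱχ D σ z * profileWeight 160 C z ∧ dist y z < 3 * 160 / 8 with hF
  set t : E3 → Finset E3 := fun x₀ => P.motif.filter fun y => ∃ g ∈ P.lattice, y + g ∈ P.points ∧ dist (y + g) x₀ ≤ 3 / 2 with ht
  have hsub : (P.motif.filter fun y =>
      octSiteWith (fun y z => ¬OctClean P (6 / 5) X y z) (1 / 2) (6 / 5) (3 / 2) (siteW ϱχ D σ X 160 C) X β P y ≠ 0) ⊆ F.biUnion t := by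
    intro y hy
    obtain ⟨hyM, hne⟩ := Finset.mem_filter.1 hy
    obtain ⟨x₀, hx₀, g, hg, hgP, hgd⟩ := collar_witness ϱχ σ h6 h7 h11 (P.mem_points_of_mem_motif hyM) hne
    exact Finset.mem_biUnion.2 ⟨x₀, hx₀, Finset.mem_filter.2 ⟨hyM, g, hg, hgP, hgd⟩⟩
  have hc1 := Finset.card_le_card hsub
  have hc2 : ((F.biUnion t).card : ℝ) ≤ ∑ x₀ ∈ F, ((t x₀).card : ℝ) := by exact_mod_cast Finset.card_biUnion_le
  have hc3 : (∑ x₀ ∈ F, ((t x₀).card : ℝ)) ≤ ∑ x₀ ∈ F, (216 : ℝ) := Finset.sum_le_sum fun x₀ _ => card_attached_le h1 x₀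
  rw [Finset.sum_const, nsmul_eq_mul] at hc3
  rw [show pricedNearCountL ϱχ D σ P X 160 C = F.card from by rw [hF]; rfl]
  calc ((P.motif.filter fun y => octSiteWith (fun y z => ¬OctClean P (6 / 5) X y z) (1 / 2) (6 / 5) (3 / 2) (siteW ϱχ D σ X 160 C) X β P y
          ≠ 0).card : ℝ) ≤ (F.biUnion t).card := by exact_mod_cast hc1
    _ ≤ ∑ x₀ ∈ F, ((t x₀).card : ℝ) := hc2
    _ ≤ F.card * 216 := hc3
    _ = 216 * F.card := mul_comm _ _

/-- A finite sum of terms `≥ −B`, of which at most `K` are non-zero, is `≥ −B·K`. -/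
theorem sum_ge_of_card_ne_zero {s : Finset E3} {f : E3 → ℝ} {B K : ℝ} (hB : 0 ≤ B) (hf : ∀ y ∈ s, -B ≤ f y)
    (hK : ((s.filter fun y => f y ≠ 0).card : ℝ) ≤ K) : -(B * K) ≤ ∑ y ∈ s, f y := by
  classical
  rw [← Finset.sum_filter_ne_zero]
  have hc0 : (0 : ℝ) ≤ (s.filter fun y => f y ≠ 0).card := Nat.cast_nonneg _
  calc -(B * K) ≤ ∑ y ∈ s.filter (fun y => f y ≠ 0), (-B : ℝ) := by
        rw [Finset.sum_const, nsmul_eq_mul]; nlinarith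
    _ ≤ _ := Finset.sum_le_sum fun y hy => hf y (Finset.mem_filter.1 hy).1

end Counting

/-! ## §D5 ★★ Piece (C) PROVED at the designate, and the cone with (C) discharged -/

section CollarProved

/-- ★★ PIECE (C) [OCT-COLLAR-q] PROVED at the designate dials, for every class and every other dial: `c_H = 81·216⁴/120000`. -/
theorem octCollarQ_designate (cls : Set E3 → Prop) (lam ℓ μ₀ b₀ r_S b₁ ϱχ : ℝ) :
    OctCollarQ cls (3 / 5) lam ℓ μ₀ (3 / 100) 160 b₀ r_S b₁ ϱχ (6 / 5) (3 / 2) (1 / 2) := by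
  refine ⟨81 / 20000 * 216 ^ 2 / 6 * 216 * 216, by norm_num, ?_⟩
  intro P C X β₀ k S m D σ h1 h2 hcl h3 h4 h5 h6 h7 h8 h9 hq h10 h11
  have hW0 : ∀ x, 0 ≤ siteW ϱχ D σ X 160 C x := fun x => siteW_nonneg X 160 C x
  have hW1 : ∀ x, siteW ϱχ D σ X 160 C x ≤ 1 := fun x => siteW_le_one ϱχ D σ X 160 C x
  have hWX : ∀ x ∈ X, siteW ϱχ D σ X 160 C x = 0 := fun x hx => siteW_of_mem 160 C hx
  unfold octCollarL
  have key := sum_ge_of_card_ne_zero (s := P.motif)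
    (f := fun y => octSiteWith (fun y z => ¬OctClean P (6 / 5) X y z) (1 / 2) (6 / 5) (3 / 2) (siteW ϱχ D σ X 160 C) X
      (volterraField P S β₀) P y)
    (B := 81 / 20000 * 216 ^ 2 / 6 * 216) (K := 216 * (pricedNearCountL ϱχ D σ P X 160 C : ℝ)) (by norm_num)
    (fun y _ => octSiteWith_lb h1 hW0 hW1 hWX h10 _ y) (card_collar_ne_zero_le h1 ϱχ σ h6 h7 h11)
  linarith

/-- ★★★ The q-DESIGNATE over the octahedral ledger with (K₀), (G) AND (C) discharged: twenty leaves + the floor + the census form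
`Fcc.FccScaleNumerics`; of NODE 73's pieces only (L) `OctLedgerQ` and (K₁) `OctShellQ` (THE CRUX) remain. -/
theorem chargedEnergyGap_of_octahedralLedger_numerics' {b₁ : ℝ} (hb : 1 / 8 ≤ b₁) (hU : Fcc.FccScaleNumerics) (hF : ChargeRecount)
    (hIP : ImprovablePricingG (3 / 20) (1 / 10) (6 / 5) 10 (1 / 100) (3 / 5))
    (hFCP : FrustratedCorePricingG (3 / 20) (1 / 10) (6 / 5) 10 (1 / 100) 40 (3 / 5))
    (hCCP : CoherentCorePricingG (3 / 20) (1 / 10) (6 / 5) 10 (1 / 100) 40 (1 / 10) 40 (3 / 5))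
    (hB : CoreBallRegularPricingW (maxCoverWeights (3 / 20) (1 / 10) (6 / 5) 10 (1 / 100) 40 (1 / 10) 40 160) (1 / 20) (3 / 5) 10
      fun _ _ => True)
    (hLab : CleanLabellingW (maxCoverWeights (3 / 20) (1 / 10) (6 / 5) 10 (1 / 100) 40 (1 / 10) 40 160) (3 / 5) 10 (1 / 3) 3)
    (hSB : ShellBudgetW (maxCoverWeights (3 / 20) (1 / 10) (6 / 5) 10 (1 / 100) 40 (1 / 10) 40 160) (3 / 5) 100000)
    (hLf : LoadBoundQ IsFccImage (3 / 5) (1 / 3) 3 (1 / 100) (3 / 100) 160 (2 / 5) 3 b₁ 80 (6 / 5) (3 / 4) (3 / 10000000) (9 / 1000000))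
    (hNf : NnStiffCls IsFccImage (27 / 10) (6 / 5))
    (hOL : OctLedgerQ (IsCubicFccImage (1921 / 2000) (977 / 1000)) (3 / 5) (1 / 3) 3 (1 / 100) (3 / 100) 160 (2 / 5) 3 b₁ 80 (6 / 5) (3 / 2)
      (1 / 2) (679 / 1000) (691 / 1000))
    (hOS : OctShellQ (IsCubicFccImage (1921 / 2000) (977 / 1000)) (3 / 5) (1 / 3) 3 (1 / 100) (3 / 100) 160 (2 / 5) 3 b₁ 80 (6 / 5) (3 / 2)
      (1 / 2) (1 / 60000000) (1 / 2000000))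
    (hFf : FarTrussQ IsFccImage (3 / 5) (1 / 3) 3 (1 / 100) (3 / 100) 160 (2 / 5) 3 b₁ 80 (6 / 5) (3 / 2) (11 / 20) (1 / 25) (1 / 60000000)
      (1 / 2000000))
    (hGf : GeoExchQ IsFccImage (3 / 5) (1 / 3) 3 (1 / 100) (3 / 100) 160 (2 / 5) 3 b₁ 80 (6 / 5) (3 / 20) (1 / 25) (1 / 30000000) (1 / 1000000))
    (hLh : LoadBoundQ IsHcpImage (3 / 5) (1 / 3) 3 (1 / 100) (3 / 100) 160 (2 / 5) 3 b₁ 80 (6 / 5) (3 / 4) (3 / 10000000) (9 / 1000000))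
    (hNh : NnStiffCls IsHcpImage (27 / 10) (6 / 5))
    (hMh : MidTrussQ IsHcpImage (3 / 5) (1 / 3) 3 (1 / 100) (3 / 100) 160 (2 / 5) 3 b₁ 80 (6 / 5) (3 / 2) (1 / 2) 0 (1 / 60000000) (1 / 2000000))
    (hFh : FarTrussQ IsHcpImage (3 / 5) (1 / 3) 3 (1 / 100) (3 / 100) 160 (2 / 5) 3 b₁ 80 (6 / 5) (3 / 2) (1 / 2) (1 / 40) (1 / 60000000)
      (1 / 2000000))
    (hGh : GeoExchQ IsHcpImage (3 / 5) (1 / 3) 3 (1 / 100) (3 / 100) 160 (2 / 5) 3 b₁ 80 (6 / 5) (1 / 5) (1 / 40) (1 / 30000000) (1 / 1000000))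
    (hN : LocalSeamReductionQ (3 / 5) (1 / 3) 3 (1 / 100) (3 / 100) (1 / 2) 160 (2 / 5) 3 b₁ 80 (1 / 3000000) (1 / 100000)
      (maxCoverWeights (3 / 20) (1 / 10) (6 / 5) 10 (1 / 100) 40 (1 / 10) 40 160) (1 / 20) 10 100000)
    (hP : ChartedChargePricingG (3 / 20) (1 / 10) (3 / 5)) : ChargedEnergyGap :=
  chargedEnergyGap_of_octahedralLedger_numerics hb hU hF hIP hFCP hCCP hB hLab hSB hLf hNf hOL hOS
    (octCollarQ_designate _ _ _ _ _ _ _ _) hFf hGf hLh hNh hMh hFh hGh hN hP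

end CollarProved

end Summit.AtomisticToContinuum.Crystallization.Theorems.ChargedEnergyGapChartDial
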